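import Literature.NumberTheory.Automorphic.RelNormOneTorus
import HarnessLib

/-!
# Levels of the norm-one torus: finiteness of `L¹ \ U(1)(𝔸_K) / U` (CM points) and Haar measure on `U(1)(𝔸_K)`

Topic `NumberTheory/Automorphic`; namespace `Literature.NumberTheory.Automorphic`. Continuation of
`RelNormOneTorus` (`relNormOneIdeles K L = U(1)_{L/K}(𝔸_K)`, `relNormOneRat K L = L¹`,
`compactSpace_relNormOneQuot : CompactSpace (U(1)(𝔸_K) ⧸ L¹)`). PROVED here, nothing cited or posited:

* `compactSpace_relNormOneQuot_of_le` — every quotient `U(1)(𝔸_K) ⧸ H` with `L¹ ≤ H` is compact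
  (continuous image of `[U(1)]` under the change-of-level map `relNormOneQuotMap`);
* **`finite_relNormOneQuot_of_isOpen_of_le`** — for an OPEN subgroup `H ⊇ L¹` the quotient `U(1)(𝔸_K) ⧸ H`
  is FINITE (discrete, Mathlib `QuotientGroup.discreteTopology`, and compact); in particular
  **`finite_relNormOneLevelQuot`**: the double coset space `L¹ \ U(1)(𝔸_K) / U = U(1)(𝔸_K) ⧸ (L¹ ⊔ U)`
  (`relNormOneLevelQuot K L U`, the group being abelian) is finite for every open subgroup `U` — the
  class number of the torus at level `U` is finite. For a CM field `L` and `K = L⁺` these classes index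
  the CM points of `U(W)`-type (a hermitian line `W`) at level `U_f` on the unitary Shimura variety, and
  only finitely many automorphic characters of `[U(W)]` have a given level
  (`finite_unitaryLineLevelQuot`). This is the finiteness of class numbers of algebraic groups
  (Borel 1963; Platonov–Rapinchuk Thm. 5.1) in the anisotropic-torus case, where it is a corollary of
  compactness;
* the Haar measure `dy` on the locally compact abelian group `U(1)(𝔸_K)` itself
  (`haarRelNormOneIdeles`, left and right invariant) — the measure of the adelic torus integrals
  `∫_{U(W)(𝔸)} ⟨ω(y)φ, φ⟩ χ(y) dy` of the Rallis inner product formula;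
* the Haar PROBABILITY measure `du` on the compact quotient `[U(1)] = L¹ \ U(1)(𝔸_K)`
  (`probHaarRelNormOneQuot K L := Measure.haarMeasure ⊤`, total mass `1`, left/right invariant, unique:
  `eq_probHaarRelNormOneQuot`) — the `du` of `∫_{[U(W)]} … du` (file `RelNormOneTorus` has the un-normalised
  finite Haar measure `haarRelNormOneQuot`).

## References

* V. Platonov, A. Rapinchuk, *Algebraic Groups and Number Theory* (1994), Thm. 5.1 (finiteness of the
  class number), Thm. 5.5. [PlatonovRapinchuk1994]
* A. Borel, *Some finiteness properties of adele groups over number fields*, Publ. Math. IHÉS 16 (1963),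
  Thm. 5.1. [Borel1963]

## Provenance

Reproduced for the tree under the LEAN-IN-TREE rule from the pub-hodgecm cell's package file
`HodgeCM/PerL34/NormOneRelTorusFinite.lean` (98 lines; seat pv11-g4, gate run 25), re-based on the tree port
`RelNormOneTorus`; the Haar-on-`U(1)(𝔸)` and probability-Haar-on-`[U(1)]` blocks are new bookkeeping (the
latter after PKG `PerL34/SeesawTorus` § 4). Model-construction cell node W8t (ii).
-/

set_option autoImplicit false

noncomputable section

open _root_.Topology _root_.Set _root_.Function _root_.MeasureTheory
open NumberField IsDedekindDomain

namespace Literature.NumberTheory.Automorphic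

/-! ## § 1. Change of level and finiteness -/

section LevelFinite

variable (K L : Type) [Field K] [Field L] [NumberField L] [Algebra K L] [FiniteDimensional K L]

/-- The change-of-level map `[U(1)] = U(1)(𝔸_K) ⧸ L¹ → U(1)(𝔸_K) ⧸ H` for `L¹ ≤ H`. [folklore] -/
def relNormOneQuotMap (H : Subgroup (relNormOneIdeles K L)) (hle : relNormOneRat K L ≤ H) :
    relNormOneIdeles K L ⧸ relNormOneRat K L →* relNormOneIdeles K L ⧸ H :=
  QuotientGroup.map (relNormOneRat K L) H (MonoidHom.id _) (by simpa using hle)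

/-- The change-of-level map on classes. [folklore] -/
@[simp] theorem relNormOneQuotMap_mk (H : Subgroup (relNormOneIdeles K L)) (hle : relNormOneRat K L ≤ H)
    (x : relNormOneIdeles K L) :
    relNormOneQuotMap K L H hle (QuotientGroup.mk x) = QuotientGroup.mk x := rfl

/-- The change-of-level map is continuous. [folklore] -/
theorem continuous_relNormOneQuotMap (H : Subgroup (relNormOneIdeles K L))
    (hle : relNormOneRat K L ≤ H) : Continuous (relNormOneQuotMap K L H hle) :=
  (QuotientGroup.isQuotientMap_mk (relNormOneRat K L)).continuous_iff.mpr QuotientGroup.continuous_mk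

/-- The change-of-level map is surjective. [folklore] -/
theorem relNormOneQuotMap_surjective (H : Subgroup (relNormOneIdeles K L))
    (hle : relNormOneRat K L ≤ H) : Function.Surjective (relNormOneQuotMap K L H hle) := by
  rintro ⟨x⟩
  exact ⟨QuotientGroup.mk x, rfl⟩

/-- **The level quotient** `L¹ \ U(1)(𝔸_K) / U := U(1)(𝔸_K) ⧸ (L¹ ⊔ U)` of the (abelian) torus at a
subgroup `U` ("level"; typically compact open, or `U_∞ U_f`). [folklore] -/
abbrev relNormOneLevelQuot (U : Subgroup (relNormOneIdeles K L)) : Type :=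
  relNormOneIdeles K L ⧸ (relNormOneRat K L ⊔ U)

/-- The class of a torus element at level `U`. [folklore] -/
abbrev relNormOneLevelQuot.mk (U : Subgroup (relNormOneIdeles K L)) (y : relNormOneIdeles K L) :
    relNormOneLevelQuot K L U := QuotientGroup.mk y

/-- Two torus elements have the same class at level `U` iff they differ by `L¹ · U`. [folklore] -/
theorem relNormOneLevelQuot.mk_eq_mk_iff (U : Subgroup (relNormOneIdeles K L))
    (y y' : relNormOneIdeles K L) :
    relNormOneLevelQuot.mk K L U y = relNormOneLevelQuot.mk K L U y' ↔
      y⁻¹ * y' ∈ relNormOneRat K L ⊔ U :=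
  QuotientGroup.eq

variable [NumberField K]

/-- Every quotient of `U(1)(𝔸_K)` by a subgroup containing `L¹` is compact. [folklore] -/
theorem compactSpace_relNormOneQuot_of_le (H : Subgroup (relNormOneIdeles K L))
    (hle : relNormOneRat K L ≤ H) : CompactSpace (relNormOneIdeles K L ⧸ H) := by
  refine ⟨?_⟩
  rw [← (relNormOneQuotMap_surjective K L H hle).range_eq, ← Set.image_univ]
  exact isCompact_univ.image (continuous_relNormOneQuotMap K L H hle)

/-- **Finiteness of the level quotients of the torus**: for every open subgroup `H ⊇ L¹` of `U(1)(𝔸_K)`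
the quotient `U(1)(𝔸_K) ⧸ H` is finite (discrete and compact). [cite: PlatonovRapinchuk1994, Thm. 5.1] -/
theorem finite_relNormOneQuot_of_isOpen_of_le (H : Subgroup (relNormOneIdeles K L))
    (hH : IsOpen (H : Set (relNormOneIdeles K L))) (hle : relNormOneRat K L ≤ H) :
    Finite (relNormOneIdeles K L ⧸ H) := by
  haveI : DiscreteTopology (relNormOneIdeles K L ⧸ H) := QuotientGroup.discreteTopology hH
  haveI : CompactSpace (relNormOneIdeles K L ⧸ H) := compactSpace_relNormOneQuot_of_le K L H hle
  exact finite_of_compact_of_discrete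

/-- **The double coset space `L¹ \ U(1)(𝔸_K) / U` is finite** for every open subgroup ("level") `U`:
the class number of the torus `U(1)_{L/K}` at level `U` is finite. [cite: PlatonovRapinchuk1994, Thm. 5.1] -/
instance finite_relNormOneLevelQuot (U : Subgroup (relNormOneIdeles K L))
    [hU : Fact (IsOpen (U : Set (relNormOneIdeles K L)))] : Finite (relNormOneLevelQuot K L U) :=
  finite_relNormOneQuot_of_isOpen_of_le K L _ (Subgroup.isOpen_mono le_sup_right hU.out) le_sup_left

/-- Unbundled form: `U(1)(𝔸_K) ⧸ (L¹ ⊔ U)` is finite for `U` open. [cite: PlatonovRapinchuk1994, Thm. 5.1] -/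
theorem finite_relNormOneQuot_sup_of_isOpen (U : Subgroup (relNormOneIdeles K L))
    (hU : IsOpen (U : Set (relNormOneIdeles K L))) :
    Finite (relNormOneIdeles K L ⧸ (relNormOneRat K L ⊔ U)) :=
  finite_relNormOneQuot_of_isOpen_of_le K L _ (Subgroup.isOpen_mono le_sup_right hU) le_sup_left

/-- More generally `U(1)(𝔸_K) ⧸ (L¹ ⊔ U)` is finite as soon as `U` contains an open subgroup (e.g.
`U = U_∞ U_f` with `U_f` compact open in the finite part and `U_∞` arbitrary). [folklore] -/
theorem finite_relNormOneQuot_sup_of_open_le (U U₀ : Subgroup (relNormOneIdeles K L))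
    (hU₀ : IsOpen (U₀ : Set (relNormOneIdeles K L))) (hle : U₀ ≤ U) :
    Finite (relNormOneIdeles K L ⧸ (relNormOneRat K L ⊔ U)) :=
  finite_relNormOneQuot_of_isOpen_of_le K L _
    (Subgroup.isOpen_mono (le_sup_right.trans (sup_le_sup_left hle _)) hU₀) le_sup_left

end LevelFinite

/-! ## § 2. Haar measure on the adelic torus `U(1)(𝔸_K)` -/

section Haar

variable (K L : Type) [Field K] [Field L] [NumberField K] [NumberField L] [Algebra K L]

/-- Borel σ-algebra on `U(1)_{L/K}(𝔸_K)`. [folklore] -/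
instance measurableSpace_relNormOneIdeles : MeasurableSpace (relNormOneIdeles K L) := borel _

/-- `U(1)_{L/K}(𝔸_K)` is a Borel space. [folklore] -/
instance borelSpace_relNormOneIdeles : BorelSpace (relNormOneIdeles K L) := ⟨rfl⟩

/-- The Haar measure `dy` on the locally compact abelian group `U(1)_{L/K}(𝔸_K)`. [folklore] -/
def haarRelNormOneIdeles : Measure (relNormOneIdeles K L) := Measure.haar

/-- `dy` is a Haar measure. [folklore] -/
instance isHaarMeasure_haarRelNormOneIdeles : (haarRelNormOneIdeles K L).IsHaarMeasure := by
  unfold haarRelNormOneIdeles; infer_instance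

/-- `dy` is right invariant (the group is abelian). [folklore] -/
instance isMulRightInvariant_haarRelNormOneIdeles : (haarRelNormOneIdeles K L).IsMulRightInvariant := by
  refine ⟨fun g => ?_⟩
  have h : (fun x : relNormOneIdeles K L => x * g) = fun x => g * x := funext fun x => mul_comm x g
  rw [h]
  exact map_mul_left_eq_self _ g

end Haar

/-! ## § 3. The Haar probability measure `du` on `[U(1)] = L¹ \ U(1)(𝔸_K)` -/

section ProbHaar

variable (K L : Type) [Field K] [Field L] [NumberField K] [NumberField L] [Algebra K L]

/-- `[U(1)]` is nonempty. [folklore] -/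
instance nonempty_relNormOneQuot : Nonempty (relNormOneIdeles K L ⧸ relNormOneRat K L) := ⟨1⟩

/-- `du` on `[U(1)]` normalised by `vol [U(1)] = 1`: the Haar probability measure of the compact abelian group
`U(1)(K) \ U(1)(𝔸_K)`. [folklore] -/
def probHaarRelNormOneQuot : Measure (relNormOneIdeles K L ⧸ relNormOneRat K L) := Measure.haarMeasure ⊤

/-- It is a Haar measure. [folklore] -/
instance isHaarMeasure_probHaarRelNormOneQuot : (probHaarRelNormOneQuot K L).IsHaarMeasure := by
  unfold probHaarRelNormOneQuot; infer_instance

/-- It is a probability measure. [folklore] -/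
instance isProbabilityMeasure_probHaarRelNormOneQuot : IsProbabilityMeasure (probHaarRelNormOneQuot K L) := by
  refine ⟨?_⟩
  have h := Measure.haarMeasure_self (G := relNormOneIdeles K L ⧸ relNormOneRat K L) (K₀ := ⊤)
  rwa [TopologicalSpace.PositiveCompacts.coe_top] at h

/-- It charges open sets. [folklore] -/
instance isOpenPosMeasure_probHaarRelNormOneQuot : (probHaarRelNormOneQuot K L).IsOpenPosMeasure := inferInstance

/-- It is left invariant. [folklore] -/
instance isMulLeftInvariant_probHaarRelNormOneQuot : (probHaarRelNormOneQuot K L).IsMulLeftInvariant :=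
  inferInstance

/-- It is right invariant (the group is abelian). [folklore] -/
instance isMulRightInvariant_probHaarRelNormOneQuot : (probHaarRelNormOneQuot K L).IsMulRightInvariant := by
  refine ⟨fun g => ?_⟩
  rw [show (fun x : relNormOneIdeles K L ⧸ relNormOneRat K L => x * g) = fun x => g * x from
    funext fun x => mul_comm x g]
  exact map_mul_left_eq_self _ g

/-- Total mass one. [folklore] -/
theorem probHaarRelNormOneQuot_univ : probHaarRelNormOneQuot K L univ = 1 := measure_univ

/-- Uniqueness: it is THE Haar probability measure on `[U(1)]`. [folklore] -/
theorem eq_probHaarRelNormOneQuot (μ : Measure (relNormOneIdeles K L ⧸ relNormOneRat K L)) [μ.IsHaarMeasure]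
    [IsProbabilityMeasure μ] : μ = probHaarRelNormOneQuot K L :=
  Measure.isHaarMeasure_eq_of_isProbabilityMeasure _ _

end ProbHaar

/-! ## § 4. CM notation: the hermitian line over `L/L⁺` -/

section CM

variable (L : Type) [Field L] [NumberField L]

/-- For a hermitian line `W` over `L/L⁺` (`U(W) = U(1)_{L/L⁺}`; no CM hypothesis is needed for the
statement): `U(W)(L⁺) \ U(W)(𝔸) / U` is finite for every open `U ≤ U(W)(𝔸)` — finitely many CM points of
`U(W)`-type at each level, finitely many automorphic characters of `[U(W)]` of each level.
[cite: PlatonovRapinchuk1994, Thm. 5.1] -/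
theorem finite_unitaryLineLevelQuot (U : Subgroup (relNormOneIdeles (maximalRealSubfield L) L))
    (hU : IsOpen (U : Set (relNormOneIdeles (maximalRealSubfield L) L))) :
    Finite (relNormOneLevelQuot (maximalRealSubfield L) L U) :=
  finite_relNormOneQuot_sup_of_isOpen (maximalRealSubfield L) L U hU

end CM

end Literature.NumberTheory.Automorphic

end
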